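import Summits.Ventures.PercRepro.Night2ParallelGeneralCore
import Summits.Ventures.PercRepro.S3ShadowLayers

/-!
# PercRepro — the parallel reduction of the LEVEL-WISE shadow form, core (night-2, gen 11)

The level-wise shadow form `ShadowHallLevel M p q u c` (`Night2ShadowForm`) counts, above a family
`𝒜 ⊆ Uq M p q`, the rank-`u` sets (`q < u < p`) instead of the whole middle band.  This file carries the
wrapper lemmas and the parallel reduction of `Night2ParallelGeneralCore` over to that form:

* `levelSet_truncate`, `shadowLevel_truncate`, `shadowHallLevel_of_truncate`: the rank-`u` level is unchanged
  by the truncation to rank `p > u`;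
* `mem_levelSet_of_delete_loop`, `shadowHallLevel_of_delete_loop`: loops are harmless, level-wise;
* `insert_mem_shadowLevel_of_contract`, `shadowLevel_delete_subset`: the contraction / deletion halves of the
  rank-`u` shadow (`S′ ∪ {e}` for a rank-`(u − 1)` set `S′` of `M ／ {e}`; the rank-`u` sets of `M ＼ {e}`);
* **`shadowLevel_card_of_parallel`**: the parallel reduction, level-wise — `e' ∈ cl {e}`, `e ≠ e'`, `r(M) = p`,
  `0 ≤ c ≤ c'`, `ShadowHallLevel (M ／ {e'}) (p − 1) (q − 1) (u − 1) c'` (needed only for `q ≥ 1`) and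
  `ShadowHallLevel (M ＼ {e'}) p q u c` give `c · #𝒜 ≤ #shadowLevel M u 𝒜`.
`Night2ParallelLevel.lean` draws the consequence `shadowC025Level_of_simple`.
-/

open scoped Matroid

namespace PercRepro.Shadow

open Finset PerFlat ThmH

variable {α : Type} [DecidableEq α] {M : Matroid α} [M.Finite]

section LevelWrapper

omit [DecidableEq α] in
/-- The rank-`u` level is unchanged by the truncation to rank `p > u`. -/
theorem levelSet_truncate (M : Matroid α) [M.Finite] {p u : ℕ} (hup : u < p) :
    levelSet (PercRepro.Matroid.truncate M p) u = levelSet M u := by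
  ext S
  rw [mem_levelSet, mem_levelSet, gr_truncate, PercRepro.Matroid.truncate_eRk]
  constructor
  · rintro ⟨hS, h⟩
    refine ⟨hS, ?_⟩
    rcases le_or_gt (M.eRk (S : Set α)) (p : ℕ∞) with hle | hlt
    · rwa [min_eq_left hle] at h
    · rw [min_eq_right hlt.le] at h
      have : p = u := by exact_mod_cast h
      omega
  · rintro ⟨hS, h⟩
    refine ⟨hS, ?_⟩
    rw [h, min_eq_left]
    exact_mod_cast hup.le

/-- The rank-`u` shadow of a family is unchanged by the truncation to rank `p > u`. -/
theorem shadowLevel_truncate (M : Matroid α) [M.Finite] {p u : ℕ} (hup : u < p) (𝒜 : Finset (Finset α)) :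
    shadowLevel (PercRepro.Matroid.truncate M p) u 𝒜 = shadowLevel M u 𝒜 := by
  ext S
  rw [mem_shadowLevel, mem_shadowLevel, levelSet_truncate M hup]

/-- The level-wise shadow condition descends from the truncation to rank `p`. -/
theorem shadowHallLevel_of_truncate (M : Matroid α) [M.Finite] {p q u : ℕ} (hqp : q < p) (hup : u < p)
    {c : ℚ} (h : ShadowHallLevel (PercRepro.Matroid.truncate M p) p q u c) : ShadowHallLevel M p q u c := by
  intro 𝒜 h𝒜
  have := h 𝒜 (h𝒜.trans (Uq_subset_truncate M hqp))
  rwa [shadowLevel_truncate M hup] at this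

/-- A rank-`u` set of `M ＼ {ℓ}` (`ℓ` a loop) is a rank-`u` set of `M`, and so is the set with the loop added. -/
theorem mem_levelSet_of_delete_loop {ℓ : α} (hℓ : ℓ ∈ M.E) (hl : ¬ M.Indep {ℓ}) {u : ℕ} {S : Finset α}
    (hS : S ∈ levelSet (M ＼ ({ℓ} : Set α)) u) : ℓ ∉ S ∧ S ∈ levelSet M u ∧ insert ℓ S ∈ levelSet M u := by
  rw [mem_levelSet, gr_delete] at hS
  obtain ⟨hSg, h1⟩ := hS
  have hℓS : ℓ ∉ S := fun h => (Finset.mem_erase.1 (hSg h)).1 rfl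
  have hSg' : S ⊆ gr M := hSg.trans (Finset.erase_subset _ _)
  have hX : ((S : Finset α) : Set α) ⊆ M.E \ {ℓ} := by
    rw [← coe_gr, ← Finset.coe_erase]; exact_mod_cast hSg
  rw [delete_singleton_eRk_eq hX] at h1
  have hins : M.eRk ((insert ℓ S : Finset α) : Set α) = M.eRk (S : Set α) := by
    rw [Finset.coe_insert]
    exact eRk_insert_loop hℓ hl (by rw [← coe_gr]; exact_mod_cast hSg')
  refine ⟨hℓS, ?_, ?_⟩
  · rw [mem_levelSet]; exact ⟨hSg', h1⟩
  · rw [mem_levelSet, hins]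
    exact ⟨Finset.insert_subset (by rw [← Finset.mem_coe, coe_gr]; exact hℓ) hSg', h1⟩

/-- **Loops are harmless, level-wise**: the rank-`u` shadow condition for `M ＼ {ℓ}` (`ℓ` a loop) gives it
for `M`. -/
theorem shadowHallLevel_of_delete_loop {ℓ : α} (hℓ : ℓ ∈ M.E) (hl : ¬ M.Indep {ℓ}) {p q u : ℕ}
    {c : ℚ} (hc : 0 ≤ c) (h : ShadowHallLevel (M ＼ ({ℓ} : Set α)) p q u c) : ShadowHallLevel M p q u c := by
  intro 𝒜 h𝒜
  -- the members with the loop removed, and the members avoiding the loop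
  set 𝒜' : Finset (Finset α) := 𝒜.image (fun B => B.erase ℓ) with h𝒜'
  set 𝒜₀ : Finset (Finset α) := 𝒜.filter (fun B => ℓ ∉ B) with h𝒜₀
  have h𝒜'U : 𝒜' ⊆ Uq (M ＼ ({ℓ} : Set α)) p q := by
    intro B' hB'
    rw [h𝒜', Finset.mem_image] at hB'
    obtain ⟨B, hB, rfl⟩ := hB'
    exact erase_mem_Uq_delete_loop hℓ hl (h𝒜 hB)
  have h𝒜₀U : 𝒜₀ ⊆ Uq (M ＼ ({ℓ} : Set α)) p q := by
    intro B hB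
    rw [h𝒜₀, Finset.mem_filter] at hB
    have := erase_mem_Uq_delete_loop hℓ hl (h𝒜 hB.1)
    rwa [Finset.erase_eq_of_notMem hB.2] at this
  -- #𝒜 ≤ #𝒜' + #𝒜₀
  have hcount : 𝒜.card ≤ 𝒜'.card + 𝒜₀.card := by
    have h1 : (𝒜 \ 𝒜₀).card ≤ 𝒜'.card := by
      apply Finset.card_le_card_of_injOn (fun B => B.erase ℓ)
      · intro B hB
        rw [Finset.coe_sdiff] at hB
        exact Finset.mem_image_of_mem _ hB.1
      · intro B₁ hB₁ B₂ hB₂ h12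
        rw [Finset.coe_sdiff] at hB₁ hB₂
        have e₁ : ℓ ∈ B₁ := by
          by_contra hne
          exact hB₁.2 (by rw [Finset.mem_coe, h𝒜₀, Finset.mem_filter]; exact ⟨hB₁.1, hne⟩)
        have e₂ : ℓ ∈ B₂ := by
          by_contra hne
          exact hB₂.2 (by rw [Finset.mem_coe, h𝒜₀, Finset.mem_filter]; exact ⟨hB₂.1, hne⟩)
        have h12' : B₁.erase ℓ = B₂.erase ℓ := h12
        rw [← Finset.insert_erase e₁, ← Finset.insert_erase e₂, h12']
    have h2 : 𝒜.card = (𝒜 \ 𝒜₀).card + 𝒜₀.card := by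
      rw [Finset.card_sdiff_add_card_eq_card (Finset.filter_subset _ _)]
    omega
  -- the two halves of the rank-u shadow
  set S1 : Finset (Finset α) := (shadowLevel (M ＼ ({ℓ} : Set α)) u 𝒜').image (fun S => insert ℓ S) with hS1
  have hS1card : S1.card = (shadowLevel (M ＼ ({ℓ} : Set α)) u 𝒜').card := by
    apply Finset.card_image_of_injOn
    intro S hS S' hS' hSS'
    have h1 : ℓ ∉ S := (mem_levelSet_of_delete_loop hℓ hl (mem_shadowLevel.1 hS).1).1
    have h2 : ℓ ∉ S' := (mem_levelSet_of_delete_loop hℓ hl (mem_shadowLevel.1 hS').1).1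
    have hSS'' : insert ℓ S = insert ℓ S' := hSS'
    calc S = (insert ℓ S).erase ℓ := (Finset.erase_insert h1).symm
      _ = (insert ℓ S').erase ℓ := by rw [hSS'']
      _ = S' := Finset.erase_insert h2
  have hS1sub : S1 ⊆ shadowLevel M u 𝒜 := by
    intro S hS
    rw [hS1, Finset.mem_image] at hS
    obtain ⟨S', hS', rfl⟩ := hS
    rw [mem_shadowLevel] at hS' ⊢
    obtain ⟨hY, B', hB', hB'S⟩ := hS'
    refine ⟨(mem_levelSet_of_delete_loop hℓ hl hY).2.2, ?_⟩
    rw [h𝒜', Finset.mem_image] at hB'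
    obtain ⟨B, hB, rfl⟩ := hB'
    exact ⟨B, hB, (Finset.insert_erase_subset ℓ B).trans (Finset.insert_subset_insert ℓ hB'S)⟩
  have hS1ℓ : ∀ S ∈ S1, ℓ ∈ S := by
    intro S hS
    rw [hS1, Finset.mem_image] at hS
    obtain ⟨S', -, rfl⟩ := hS
    exact Finset.mem_insert_self _ _
  set S0 : Finset (Finset α) := shadowLevel (M ＼ ({ℓ} : Set α)) u 𝒜₀ with hS0
  have hS0sub : S0 ⊆ shadowLevel M u 𝒜 := by
    intro S hS
    rw [hS0, mem_shadowLevel] at hS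
    obtain ⟨hY, B, hB, hBS⟩ := hS
    rw [mem_shadowLevel]
    exact ⟨(mem_levelSet_of_delete_loop hℓ hl hY).2.1, B, (Finset.filter_subset _ _) hB, hBS⟩
  have hS0ℓ : ∀ S ∈ S0, ℓ ∉ S := by
    intro S hS
    rw [hS0, mem_shadowLevel] at hS
    exact (mem_levelSet_of_delete_loop hℓ hl hS.1).1
  have hdisj : Disjoint S1 S0 := by
    rw [Finset.disjoint_left]
    intro S h1 h0
    exact hS0ℓ S h0 (hS1ℓ S h1)
  have hunion : (S1 ∪ S0).card ≤ (shadowLevel M u 𝒜).card :=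
    Finset.card_le_card (Finset.union_subset hS1sub hS0sub)
  rw [Finset.card_union_of_disjoint hdisj, hS1card] at hunion
  have hIH1 := h 𝒜' h𝒜'U
  have hIH0 := h 𝒜₀ h𝒜₀U
  have hcount' : (𝒜.card : ℚ) ≤ (𝒜'.card : ℚ) + (𝒜₀.card : ℚ) := by
    rw [← Nat.cast_add]; exact Nat.cast_le.2 hcount
  have hunion' : ((shadowLevel (M ＼ ({ℓ} : Set α)) u 𝒜').card : ℚ) + (S0.card : ℚ)
      ≤ ((shadowLevel M u 𝒜).card : ℚ) := by
    rw [← Nat.cast_add]; exact Nat.cast_le.2 hunion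
  calc c * (𝒜.card : ℚ) ≤ c * ((𝒜'.card : ℚ) + (𝒜₀.card : ℚ)) := mul_le_mul_of_nonneg_left hcount' hc
    _ = c * (𝒜'.card : ℚ) + c * (𝒜₀.card : ℚ) := by ring
    _ ≤ ((shadowLevel (M ＼ ({ℓ} : Set α)) u 𝒜').card : ℚ) + (S0.card : ℚ) := add_le_add hIH1 hIH0
    _ ≤ ((shadowLevel M u 𝒜).card : ℚ) := hunion'

end LevelWrapper

section LevelParallel

variable {p q u : ℕ} {e e' : α}

/-- A rank-`(u − 1)` set `S′` of `M ／ {e}` above `B ∖ {e}` (`B ∈ 𝒜`, `u ≥ 1`) gives the rank-`u` set `S′ ∪ {e}`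
of `M` above `B`; such sets avoid `e`. -/
theorem insert_mem_shadowLevel_of_contract (he : M.Indep {e}) (hu : 1 ≤ u) {𝒜 : Finset (Finset α)}
    {S : Finset α} (hS : S ∈ shadowLevel (M ／ ({e} : Set α)) (u - 1) (𝒜.image (fun B => B.erase e))) :
    e ∉ S ∧ insert e S ∈ shadowLevel M u 𝒜 := by
  have heE : e ∈ M.E := he.subset_ground (Set.mem_singleton e)
  rw [mem_shadowLevel] at hS
  obtain ⟨hY, B', hB', hB'S⟩ := hS
  rw [mem_levelSet, gr_contract] at hY
  obtain ⟨hSg, hr⟩ := hY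
  have heS : e ∉ S := fun h => (Finset.mem_erase.1 (hSg h)).1 rfl
  have hSg' : S ⊆ gr M := hSg.trans (Finset.erase_subset _ _)
  refine ⟨heS, ?_⟩
  rw [mem_shadowLevel]
  refine ⟨?_, ?_⟩
  · have hX : ((S : Finset α) : Set α) ⊆ M.E \ {e} := by
      rw [← coe_gr, ← Finset.coe_erase]; exact_mod_cast hSg
    have h1 := contract_singleton_eRk_add_one he hX
    rw [hr] at h1
    have hr' : M.eRk ((insert e S : Finset α) : Set α) = (u : ℕ∞) := by
      rw [Finset.coe_insert, ← h1]
      exact_mod_cast (show u - 1 + 1 = u by omega)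
    rw [mem_levelSet, hr']
    exact ⟨Finset.insert_subset (by rw [← Finset.mem_coe, coe_gr]; exact heE) hSg', rfl⟩
  · rw [Finset.mem_image] at hB'
    obtain ⟨B, hB, rfl⟩ := hB'
    exact ⟨B, hB, (Finset.insert_erase_subset e B).trans (Finset.insert_subset_insert e hB'S)⟩

/-- The rank-`u` sets of `M ＼ {e}` above a family `𝒞 ⊆ 𝒜` are rank-`u` sets of `M` above `𝒜`, avoiding `e`. -/
theorem shadowLevel_delete_subset {𝒜 𝒞 : Finset (Finset α)} (h𝒞 : 𝒞 ⊆ 𝒜) :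
    ∀ S ∈ shadowLevel (M ＼ ({e} : Set α)) u 𝒞, e ∉ S ∧ S ∈ shadowLevel M u 𝒜 := by
  intro S hS
  rw [mem_shadowLevel] at hS
  obtain ⟨hY, B, hB, hBS⟩ := hS
  rw [mem_levelSet, gr_delete] at hY
  obtain ⟨hSg, h1⟩ := hY
  have heS : e ∉ S := fun h => (Finset.mem_erase.1 (hSg h)).1 rfl
  have hX : ((S : Finset α) : Set α) ⊆ M.E \ {e} := by
    rw [← coe_gr, ← Finset.coe_erase]; exact_mod_cast hSg
  rw [delete_singleton_eRk_eq hX] at h1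
  refine ⟨heS, ?_⟩
  rw [mem_shadowLevel, mem_levelSet]
  exact ⟨⟨hSg.trans (Finset.erase_subset _ _), h1⟩, B, h𝒞 hB, hBS⟩

/-- **The parallel reduction, level-wise.**  `e'` a non-loop with a parallel partner `e ∈ E` (`e' ∈ cl {e}`,
`e ≠ e'`), `r(M) = p`, `u ≥ 1`, `0 ≤ c ≤ c'`: if `ShadowHallLevel (M ／ {e'}) (p − 1) (q − 1) (u − 1) c'` (needed
only when `q ≥ 1`) and `ShadowHallLevel (M ＼ {e'}) p q u c`, then `c · #𝒜 ≤ #shadowLevel M u 𝒜` for every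
`𝒜 ⊆ Uq M p q`. -/
theorem shadowLevel_card_of_parallel (he'i : M.Indep {e'}) (he : e ∈ M.E) (hpar : e' ∈ M.closure {e})
    (hne : e ≠ e') (hM : M.eRank = (p : ℕ∞)) (hu : 1 ≤ u) {c c' : ℚ} (hc : 0 ≤ c) (hcc' : c ≤ c')
    {𝒜 : Finset (Finset α)} (h𝒜 : 𝒜 ⊆ Uq M p q)
    (IHc : 1 ≤ q → ShadowHallLevel (M ／ ({e'} : Set α)) (p - 1) (q - 1) (u - 1) c')
    (IHd : ShadowHallLevel (M ＼ ({e'} : Set α)) p q u c) :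
    c * (𝒜.card : ℚ) ≤ ((shadowLevel M u 𝒜).card : ℚ) := by
  -- the two halves of `𝒜`: `e' ∈ cl B` (contracted) and `e' ∉ cl B` (deleted)
  set 𝒜c : Finset (Finset α) := 𝒜.filter (fun B => e' ∈ clF M B) with h𝒜c
  set 𝒜d : Finset (Finset α) := 𝒜.filter (fun B => e' ∉ clF M B) with h𝒜d
  have h𝒜cA : 𝒜c ⊆ 𝒜 := Finset.filter_subset _ _
  have h𝒜dA : 𝒜d ⊆ 𝒜 := Finset.filter_subset _ _
  have hsplit : 𝒜.card = 𝒜c.card + 𝒜d.card := by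
    rw [h𝒜c, h𝒜d, Finset.card_filter_add_card_filter_not]
  -- the contracted family and the collision family
  set 𝒜' : Finset (Finset α) := 𝒜c.image (fun B => B.erase e') with h𝒜'
  set 𝒞 : Finset (Finset α) := 𝒜c.filter (fun B => e' ∉ B ∧ insert e' B ∈ 𝒜c) with h𝒞
  have h𝒞sub : 𝒞 ⊆ 𝒜c := Finset.filter_subset _ _
  have hcount : 𝒜c.card ≤ 𝒜'.card + 𝒞.card := by
    have := card_le_card_image_erase_add 𝒜c e'
    rwa [← h𝒜', ← h𝒞] at this
  have hq_of : ∀ B ∈ 𝒜c, 1 ≤ q := by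
    intro B hB
    rw [h𝒜c, Finset.mem_filter] at hB
    have hBU := mem_Uq.1 (h𝒜 hB.1)
    exact one_le_of_mem_clF he'i hBU.1 hBU.2.1 hB.2
  have h𝒜'U : 𝒜' ⊆ Uq (M ／ ({e'} : Set α)) (p - 1) (q - 1) := by
    intro B' hB'
    rw [h𝒜', Finset.mem_image] at hB'
    obtain ⟨B, hB, rfl⟩ := hB'
    have hq := hq_of B hB
    rw [h𝒜c, Finset.mem_filter] at hB
    exact erase_mem_Uq_contract_gen he'i hq hM (h𝒜 hB.1) hB.2
  set 𝒟 : Finset (Finset α) := 𝒞 ∪ 𝒜d with h𝒟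
  have h𝒟U : 𝒟 ⊆ Uq (M ＼ ({e'} : Set α)) p q := by
    intro B hB
    rw [h𝒟, Finset.mem_union] at hB
    rcases hB with hB | hB
    · rw [h𝒞, Finset.mem_filter] at hB
      exact mem_Uq_delete_of_insert_mem_gen (h𝒜 (h𝒜cA hB.1)) hB.2.1 (h𝒜 (h𝒜cA hB.2.2))
    · rw [h𝒜d, Finset.mem_filter] at hB
      exact mem_Uq_delete_of_notMem_clF_gen he hpar hne (h𝒜 hB.1) hB.2
  have h𝒟A : 𝒟 ⊆ 𝒜 := Finset.union_subset (h𝒞sub.trans h𝒜cA) h𝒜dA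
  have h𝒟card : 𝒟.card = 𝒞.card + 𝒜d.card := by
    rw [h𝒟, Finset.card_union_of_disjoint]
    rw [Finset.disjoint_left]
    intro B hB hBd
    rw [h𝒞, Finset.mem_filter, h𝒜c, Finset.mem_filter] at hB
    rw [h𝒜d, Finset.mem_filter] at hBd
    exact hBd.2 hB.1.2
  -- the two IH shadows inside the rank-u shadow of 𝒜, in the halves e' ∈ S / e' ∉ S
  set S1 : Finset (Finset α) :=
    (shadowLevel (M ／ ({e'} : Set α)) (u - 1) 𝒜').image (fun S => insert e' S) with hS1
  have hS1card : S1.card = (shadowLevel (M ／ ({e'} : Set α)) (u - 1) 𝒜').card := by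
    apply Finset.card_image_of_injOn
    intro S hS S' hS' hSS'
    have h1 : e' ∉ S := (insert_mem_shadowLevel_of_contract he'i hu (𝒜 := 𝒜c) (by rwa [← h𝒜'])).1
    have h2 : e' ∉ S' := (insert_mem_shadowLevel_of_contract he'i hu (𝒜 := 𝒜c) (by rwa [← h𝒜'])).1
    have hSS'' : insert e' S = insert e' S' := hSS'
    calc S = (insert e' S).erase e' := (Finset.erase_insert h1).symm
      _ = (insert e' S').erase e' := by rw [hSS'']
      _ = S' := Finset.erase_insert h2
  have hS1sub : S1 ⊆ shadowLevel M u 𝒜 := by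
    intro S hS
    rw [hS1, Finset.mem_image] at hS
    obtain ⟨S', hS', rfl⟩ := hS
    have h := (insert_mem_shadowLevel_of_contract he'i hu (𝒜 := 𝒜c) (by rwa [← h𝒜'])).2
    rw [mem_shadowLevel] at h ⊢
    obtain ⟨hl, B, hB, hBS⟩ := h
    exact ⟨hl, B, h𝒜cA hB, hBS⟩
  have hS1e : ∀ S ∈ S1, e' ∈ S := by
    intro S hS
    rw [hS1, Finset.mem_image] at hS
    obtain ⟨S', -, rfl⟩ := hS
    exact Finset.mem_insert_self _ _
  set S0 : Finset (Finset α) := shadowLevel (M ＼ ({e'} : Set α)) u 𝒟 with hS0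
  have hS0sub : S0 ⊆ shadowLevel M u 𝒜 := fun S hS => (shadowLevel_delete_subset h𝒟A S hS).2
  have hS0e : ∀ S ∈ S0, e' ∉ S := fun S hS => (shadowLevel_delete_subset h𝒟A S hS).1
  have hdisj : Disjoint S1 S0 := by
    rw [Finset.disjoint_left]
    intro S h1 h0
    exact hS0e S h0 (hS1e S h1)
  have hunion : (S1 ∪ S0).card ≤ (shadowLevel M u 𝒜).card :=
    Finset.card_le_card (Finset.union_subset hS1sub hS0sub)
  rw [Finset.card_union_of_disjoint hdisj, hS1card] at hunion
  have hIH1 : c' * (𝒜'.card : ℚ) ≤ ((shadowLevel (M ／ ({e'} : Set α)) (u - 1) 𝒜').card : ℚ) := by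
    by_cases hemp : 𝒜c = ∅
    · have h𝒜'e : 𝒜' = ∅ := by rw [h𝒜', hemp, Finset.image_empty]
      rw [h𝒜'e, Finset.card_empty, Nat.cast_zero, mul_zero]
      exact Nat.cast_nonneg _
    · obtain ⟨B, hB⟩ := Finset.nonempty_iff_ne_empty.2 hemp
      exact IHc (hq_of B hB) 𝒜' h𝒜'U
  have hIH0 := IHd 𝒟 h𝒟U
  have hA : (𝒜.card : ℚ) ≤ (𝒜'.card : ℚ) + (𝒟.card : ℚ) := by
    have h : 𝒜.card ≤ 𝒜'.card + 𝒟.card := by omega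
    rw [← Nat.cast_add]
    exact Nat.cast_le.2 h
  have hunion' : ((shadowLevel (M ／ ({e'} : Set α)) (u - 1) 𝒜').card : ℚ) + (S0.card : ℚ)
      ≤ ((shadowLevel M u 𝒜).card : ℚ) := by
    rw [← Nat.cast_add]
    exact Nat.cast_le.2 hunion
  exact (parallel_arith_gen hc hcc' (Nat.cast_nonneg _) hA hIH1 hIH0).trans hunion'

end LevelParallel

end PercRepro.Shadow
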